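import Mathlib
import Summits.KontsevichZagierPeriods.Zeta5Search.BrickOffDigitSide
import Summits.KontsevichZagierPeriods.Zeta5Search.BrickDigitStepDZero

/-!
# BrickOffDigitZero — THEOREM 6 Step G⁺ for the CONSTANT-TERM CELL `s = 0`: every OFF-DIGIT term has
`v_p(p^{2τ_0}·cell^{(0)}_K(np)) ≥ A − 2` (`K = jp + i`, `p ∤ K`, `n < p²`, `τ_0 = A − 1`; cell zeta5-irr)

HONEST FRAMING: systematic search; no irrationality claim unless certified. INSTRUMENT lemma of the ζ(5)
census cell zeta5-irr (HOME `run/shared/lean/pub/zeta5-irr/`; memo `zi-p2/probes/B8/thm6/THEOREM6.md` Step G⁺ read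
for the harmonic cell: `cell^{(0)}_K(np) = −Σ_{s=1}^{A} c_{K,s}(np)H_K^{(s)}` with `v(H_K^{(s)}) ≥ −2s` (`K < p³`) and
`v(p^{2τ_s}c_{K,s}(np)) ≥ A − 2` (`BrickOffDigitSide.offDigit_term_le`, `s ≤ A − 1`; for `s = A`,
`v(c_{K,A}(np)) = v(cTop) ≥ A` by Kummer). Nothing here is about ζ(5); no irrationality content; filing moves no rung.
Filed by the engine seat zi-eng (g8).

## The statement

`p` odd prime, `2B ≤ A`, `1 ≤ A`, `n < p²`, `j < n`, `1 ≤ i < p`, `K = jp + i`, `cellZero` of `BrickPartialFractions`: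

**`v(p^{2(A−1)}·cellZero A B 1 (np) K) ≤ exp(2 − A)`** (`offDigitZero_term_le`); hence for `A ≥ 5` every off-digit
term of `p^{2τ_0}x_0(np)` is `≡ 0 (mod p³)`.
-/

namespace Summit.KontsevichZagierPeriods.Zeta5Search.BrickOffDigitZero

open Finset Nat WithZero
open Summit.KontsevichZagierPeriods.Zeta5Search.BrickTopCoefficient (cTop)
open Summit.KontsevichZagierPeriods.Zeta5Search.BrickLaurent (cell cell_top)
open Summit.KontsevichZagierPeriods.Zeta5Search.BrickPartialFractions (cellZero)
open Summit.KontsevichZagierPeriods.Zeta5Search.BrickHarmonicBlocks (hsum)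
open Summit.KontsevichZagierPeriods.Zeta5Search.BrickDigitStepDZero (cellZero_eq hsum_valuation)
open Summit.KontsevichZagierPeriods.Zeta5Search.BrickOffDigitSide (offDigit_term_le padicValuation_cTop_offDigit_le)

noncomputable section

variable {p : ℕ} [Fact p.Prime]

/-- **Step G⁺ termwise for the harmonic cell**: `v_p(p^{2(A−1)}·cell^{(0)}_K(np)) ≥ A − 2` for `K = jp + i`,
`j < n < p²`, `1 ≤ i < p`. -/
theorem offDigitZero_term_le (hp2 : p ≠ 2) {A B n j i : ℕ} (hAB : 2 * B ≤ A) (hA : 1 ≤ A) (hn : n < p ^ 2)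
    (hjn : j < n) (hi1 : 1 ≤ i) (hip : i < p) :
    Rat.padicValuation p ((p : ℚ) ^ (2 * (A - 1)) * cellZero A B 1 (n * p) (j * p + i)) ≤ exp (2 - (A : ℤ)) := by
  have hp : p.Prime := Fact.out
  have hK : j * p + i ≤ n * p := by nlinarith
  have hnp : n * p < p ^ (2 + 1) := by rw [pow_succ]; exact Nat.mul_lt_mul_of_pos_right hn hp.pos
  have hKlt : j * p + i < p ^ (2 + 1) := lt_of_le_of_lt hK hnp
  rw [cellZero_eq, mul_neg, Valuation.map_neg, Finset.mul_sum]
  refine Valuation.map_sum_le _ fun s hs => ?_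
  have hs' := mem_Icc.1 hs
  have hH : Rat.padicValuation p (hsum s (j * p + i)) ≤ exp (((2 : ℕ) : ℤ) * s) := hsum_valuation hKlt s
  rcases Nat.lt_or_ge s A with hsA | hsA
  · -- `s ≤ A − 1`: `p^{2(A−1)}c·H = (p^{2τ_s}c)·(p^{2s}H)`
    have hoff := offDigit_term_le (p := p) hp2 hAB hn hjn hi1 hip (show s + 1 ≤ A by omega)
    rw [show (p : ℚ) ^ (2 * (A - 1)) * (cell A B 1 (n * p) (j * p + i) s * hsum s (j * p + i)) =
        ((p : ℚ) ^ (2 * (A - 1 - s)) * cell A B 1 (n * p) (j * p + i) s) * ((p : ℚ) ^ (2 * s) * hsum s (j * p + i)) by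
      rw [mul_mul_mul_comm, ← pow_add, show 2 * (A - 1 - s) + 2 * s = 2 * (A - 1) by omega],
      map_mul, map_mul (Rat.padicValuation p) ((p : ℚ) ^ (2 * s)), map_pow, Rat.padicValuation_self, ← exp_nsmul]
    refine (mul_le_mul' hoff (mul_le_mul' le_rfl hH)).trans ?_
    rw [← exp_add, ← exp_add, exp_le_exp, nsmul_eq_mul]
    push_cast
    linarith
  · -- `s = A`: `c_{K,A}(np) = cTop`, `v(cTop) ≥ A` off-digit
    have hsAeq : s = A := le_antisymm hs'.2 hsA
    subst hsAeq
    have htop := padicValuation_cTop_offDigit_le (p := p) hp2 s B 1 hn hjn hi1 hip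
    have hX := Int.natCast_nonneg
      (B * ((if p ^ 2 ≤ n + j then 1 else 0) + (if p ^ 2 ≤ 2 * n - 1 - j then 1 else 0)))
    have htop' : Rat.padicValuation p (cTop s B 1 (n * p) (j * p + i)) ≤ exp (-(s : ℤ)) :=
      htop.trans (exp_le_exp.2 (by rw [Nat.cast_add]; linarith))
    rw [cell_top hAB 1 hK, map_mul, map_mul, map_pow, Rat.padicValuation_self, ← exp_nsmul]
    refine (mul_le_mul' le_rfl (mul_le_mul' htop' hH)).trans ?_
    rw [← exp_add, ← exp_add, exp_le_exp, nsmul_eq_mul]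
    push_cast [hA]
    linarith

end

end Summit.KontsevichZagierPeriods.Zeta5Search.BrickOffDigitZero
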